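import Summits.KontsevichZagierPeriods.Zeta5Search.WedgeDictionaryDescent22Group
import Summits.KontsevichZagierPeriods.Zeta5Search.WedgeDictionaryContiguityModule
import HarnessLib

/-!
(LANE NOTE, P2 g3: the four slot-transposition lemmas `bOfA_genP01/genP12/genH/genHp` staged here are ALREADY in the
tree with identical statements (`WedgeDictionaryDescent22Group`, p235725); the local copies were deleted and that module is
imported instead — gate `name exists` bounce p249166; everything else VERBATIM, sha256 of the staged file 991ce3ae.)

# `explicitPQ` is covariant under the Brown–Zudilin group `G ≅ S₇`: transport along the five generators

HONEST FRAMING: systematic search; no irrationality claim unless certified.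
OUR work (Summit side; cell `pub-zeta5`, planner gen-1 g15, 2026-08-21; memo `pub-zeta5-gen-1/D2-CONNECTION-g15.md` §3).

Brown–Zudilin (arXiv:2210.03391v3, Sect. 7, eq. (27), PROVED there): `I(a)/∏_{i∈F} h_i(a)!` is invariant under the group
`G = ⟨i₁, p₀₁, p₁₂, h⟩ ≅ S₇` (tree: the NAMED FACT `invariance_of_converges'`, one clause per generator `i₁, p₀₁, p₁₂, h, h'`).
On the dual side `b = b(a)` the five generators are SLOT TRANSPOSITIONS: `i₁ = (14)(23)(57)` (g11, `bOfA_genI1`),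
**`p₀₁ = (34)`, `p₁₂ = (35)`, `h = (36)`, `h' = (46)`** (`bOfA_genP01`, `bOfA_genP12`, `bOfA_genH`, `bOfA_genHp`, PROVED), and the
observation of g15 is that gen-1's closed scalar FACTORS THROUGH THE NORMALISATION OF (27):

  `ρ(b) = ρ_core(b) · ∏_{i∈F} h_i(a)!`,  `ρ_core(b) = (−1)^{Σ_j b_j} / (4 · d(b)! · ∏_{j=1}^{7} b_j!)`  (`rhoB_eq_core`, `prodFNat_bOfA`),

because the seventeen forms `h_i`, `i ∈ F`, are exactly the fifteen EDGE forms `b₀ − b_j − b_k`, `(j,k) ∈ E`, of `ρ` together with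
`b₂, b₃` — and `ρ_core` is `S₇`-INVARIANT (`rhoCore_permLower`), as are `U, W, V` (tree: `coeffU/W/V_permLower`).  Hence every
component of the dictionary vector `(Q, P̂_d, P_d)` (the `Q`-component via the tree's PROVED `wedgeDictionary_Q`) transforms under
`g ∈ G` by the same factor `∏_F h_i(ga)!/∏_F h_i(a)!` as the integral does by (27), and:

* **`explicitPQAt_transport`** (PROVED, abstract form): if `b(g a) = σ • b(a)`, `I(ga)/∏h(ga)! = I(a)/∏h(a)!`, and both points
  satisfy the hypotheses of `explicitPQ` (partner `j` at `a`, partner `j' ` with `σ(j') = j` at `g a`), then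
  `ExplicitPQAt a j → ExplicitPQAt (g a) j'`;  `regionHyp_transport` (PROVED): the hypotheses themselves transport, given
  convergence at `g a`.
* **`explicitPQAt_genP01/genP12/genH/genHp`** (PROVED modulo the cited (27) only, used at one generator each): the transport along
  `p₀₁, p₁₂, h, h'`, given convergence at the image point (the convergence cone is NOT `G`-stable: `a = (5,1,1,1,5,1,1,1)`
  converges and `p₀₁ a` has the entry `a₂+a₃−a₅ = −3`; inside the region of `explicitPQ` the image converges unless a non-edge
  pair sits on the boundary `b_j = b_k = (b₀+1)/2`); with g11's `i₁` file (`cellularIntegral_genI1`, where `F` is `i₁`-stable)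
  this covers a generating set of `G` (all five generators are involutions).

Consequence for the proof architecture of `explicitPQ` (memo §5): it suffices to prove `explicitPQ` on ONE point of each `G`-orbit
(e.g. `b₁ ≥ b₂ ≥ … ≥ b₇` up to the orbit's region constraints), and seeds for the 2-of-3 induction (`WedgeDictionaryThreeTerm`)
spread over orbits.  What this file is NOT: a proof of (27) (cited), of `explicitPQ` at any new point by itself, or of anything
about irrationality.
-/

noncomputable section

open Finset

namespace Summit.KontsevichZagierPeriods.Zeta5Search.WedgeDictionary

open Summit.KontsevichZagierPeriods.Zeta5Search.DualSeries
open Literature.NumberTheory.Irrationality.BrownZudilin2022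
open Literature.NumberTheory.Transcendental (zetaValue)
open Summit.KontsevichZagierPeriods.Zeta5Search.SymmetricGauge (permLower permLower_apply_succ permLower_zero
  permLower_apply_of_not coeffU_permLower coeffV_permLower coeffW_permLower shift_permLower dOf_permLower
  sum_range7_permLower rhoB rhoOf_eq_rhoB)
open Summit.KontsevichZagierPeriods.Zeta5Search.CasoratianValuation (shift)

/-! ## 1. `ρ = ρ_core · ∏_{i∈F} h_i!` and the `S₇`-invariance of `ρ_core` -/

/-- The normalisation `∏_{i∈F} h_i!` of (27) written in the dual coordinates: the fifteen edge forms `b₀ − b_j − b_k`,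
`(j,k) ∈ E`, and `b₂, b₃` (a natural number). -/
def prodFNat (b : ℕ → ℤ) : ℕ :=
  (Epairs.map fun jk => (b 0 - b jk.1 - b jk.2).toNat.factorial).prod * ((b 2).toNat.factorial * (b 3).toNat.factorial)

/-- `prodFNat b > 0`. -/
theorem prodFNat_pos (b : ℕ → ℤ) : 0 < prodFNat b := by
  unfold prodFNat
  simp only [Epairs, List.map, List.prod_cons, List.prod_nil]
  positivity

/-- **`∏_{i∈F} h_i(a)! = prodFNat (b(a))`**: the seventeen forms of `F` are the edge forms of `ρ` and `b₂ = a₂`, `b₃ = a₄`. -/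
theorem prodFNat_bOfA (a : Fin 8 → ℤ) :
    prodFNat (bOfA a) = (Fset.map fun i => (hForm a i).toNat.factorial).prod := by
  simp [prodFNat, Epairs, Fset, hForm, hList, bOfA]
  ring_nf

/-- The normalisation of (27), as a real number, is the cast of `prodFNat (b(a))`. -/
theorem prodF_eq_cast (a : Fin 8 → ℤ) :
    (Fset.map fun i => ((hForm a i).toNat.factorial : ℝ)).prod = ((prodFNat (bOfA a) : ℕ) : ℝ) := by
  rw [prodFNat_bOfA, Nat.cast_list_prod, List.map_map]
  rfl

/-- The `S₇`-symmetric core of `ρ`: `ρ_core(b) = (−1)^{Σ_j b_j} / (4 · ∏_{j=1}^{7} b_j! · d(b)!)`. -/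
def rhoCore (b : ℕ → ℤ) : ℚ :=
  (-1 : ℚ) ^ (∑ j ∈ range 7, b (j + 1)).toNat /
    (4 * (∏ j ∈ range 7, ((b (j + 1)).toNat.factorial : ℚ)) * ((dOf b).toNat.factorial : ℚ))

/-- **`ρ(b) = ρ_core(b) · prodFNat b`** (pure bookkeeping: `b₁!b₄!b₅!b₆!b₇! · b₂!b₃! = ∏_{j=1}^7 b_j!`). -/
theorem rhoB_eq_core (b : ℕ → ℤ) : rhoB b = rhoCore b * (prodFNat b : ℚ) := by
  unfold rhoB rhoCore prodFNat
  simp only [Epairs, List.map, List.prod_cons, List.prod_nil, prod_range_succ, prod_range_zero, mul_one, one_mul]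
  push_cast
  field_simp

/-- `∏_{i<7} f(b_{σ(i)+1}) = ∏_{i<7} f(b_{i+1})`. -/
theorem prod_range7_permLower (σ : Equiv.Perm (Fin 7)) (b : ℕ → ℤ) (f : ℤ → ℚ) :
    ∏ i ∈ range 7, f (permLower σ b (i + 1)) = ∏ i ∈ range 7, f (b (i + 1)) := by
  rw [Finset.prod_range, Finset.prod_range]
  simp only [permLower_apply_succ]
  exact Equiv.prod_comp σ (fun k : Fin 7 => f (b (↑k + 1)))

/-- **`ρ_core(σ • b) = ρ_core(b)`** for every `σ ∈ S₇`. -/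
theorem rhoCore_permLower (σ : Equiv.Perm (Fin 7)) (b : ℕ → ℤ) : rhoCore (permLower σ b) = rhoCore b := by
  unfold rhoCore
  have hs := sum_range7_permLower σ b id
  have hp := prod_range7_permLower σ b (fun x => ((x.toNat.factorial : ℕ) : ℚ))
  simp only [id] at hs hp
  rw [dOf_permLower, hs, hp]

/-! ## 2. The abstract transport -/

/-- The hypotheses of `explicitPQ` transport along `g` with `b(g a) = σ • b(a)` (given convergence at `g a`): the partner
`j` at `a` becomes the partner `j' = i+1` at `g a` with `σ(i) + 1 = j`. -/
theorem regionHyp_transport {g : (Fin 8 → ℤ) → (Fin 8 → ℤ)} {σ : Equiv.Perm (Fin 7)} {a : Fin 8 → ℤ}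
    (hb : bOfA (g a) = permLower σ (bOfA a)) (hc : Converges (g a)) (i : Fin 7) {j : ℕ}
    (hj : j = (σ i).val + 1) (hr : RegionHyp a j) : RegionHyp (g a) (i.val + 1) := by
  obtain ⟨-, -, hreg, hd, hpart⟩ := hr
  have hi := i.isLt
  refine ⟨by simp only [mem_Icc]; omega, hc, ?_, ?_, ?_⟩
  · intro k hk
    simp only [mem_Icc] at hk
    obtain ⟨m, rfl⟩ : ∃ m : Fin 7, k = m.val + 1 := ⟨⟨k - 1, by omega⟩, by simp only; omega⟩
    have hm := (σ m).isLt
    rw [hb, permLower_apply_succ, permLower_zero]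
    exact hreg _ (by simp only [mem_Icc]; omega)
  · rw [hb, dOf_permLower]; exact hd
  · rw [hb, permLower_apply_succ, permLower_zero, ← hj]; exact hpart

/-- **TRANSPORT OF `explicitPQ` ALONG A GROUP ELEMENT (PROVED).**  If `b(g a) = σ • b(a)`, the quotient `I/∏_F h!` agrees
at `a` and `g a` (eq. (27)), both points satisfy the hypotheses of `explicitPQ` with partners `j` and `i+1`, `σ(i)+1 = j`,
then `explicitPQ` at `a` gives `explicitPQ` at `g a`.  Ingredients: `wedgeDictionary_Q` (tree, PROVED) for the `Q`-component,
`rhoB_eq_core` + `rhoCore_permLower` + `coeffU/W/V_permLower` + `shift_permLower` for the covariance of `(Q, P̂_d, P_d)`. -/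
theorem explicitPQAt_transport {g : (Fin 8 → ℤ) → (Fin 8 → ℤ)} {σ : Equiv.Perm (Fin 7)} {a : Fin 8 → ℤ}
    (hb : bOfA (g a) = permLower σ (bOfA a)) (hI : normalisedIntegral' (g a) = normalisedIntegral' a)
    (i : Fin 7) {j : ℕ} (hj : j = (σ i).val + 1) (hr : RegionHyp a j) (hr' : RegionHyp (g a) (i.val + 1))
    (h : ExplicitPQAt a j) : ExplicitPQAt (g a) (i.val + 1) := by
  obtain ⟨hjI, hconv, hreg, hd, hpart⟩ := hr
  obtain ⟨hjI', hconv', hreg', hd', hpart'⟩ := hr'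
  have hF1 : (0 : ℝ) < ((prodFNat (bOfA a) : ℕ) : ℝ) := by exact_mod_cast prodFNat_pos _
  have hF2 : (0 : ℝ) < ((prodFNat (bOfA (g a)) : ℕ) : ℝ) := by exact_mod_cast prodFNat_pos _
  -- (27): `I(g a) · F(a) = I(a) · F(g a)`
  have hIa : cellularIntegral (g a) * ((prodFNat (bOfA a) : ℕ) : ℝ) =
      cellularIntegral a * ((prodFNat (bOfA (g a)) : ℕ) : ℝ) := by
    unfold normalisedIntegral' at hI
    rw [prodF_eq_cast, prodF_eq_cast, div_eq_div_iff hF2.ne' hF1.ne'] at hI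
    exact hI
  -- covariance of the three dictionary components (in `ℚ`)
  have hQa := wedgeDictionary_Q a j hjI hconv hreg hd hpart
  have hQg := wedgeDictionary_Q (g a) (i.val + 1) hjI' hconv' hreg' hd' hpart'
  have hQ : (QOf (g a) : ℚ) * (prodFNat (bOfA a) : ℚ) = (QOf a : ℚ) * (prodFNat (bOfA (g a)) : ℚ) := by
    rw [hQg, hQa, rhoOf_eq_rhoB, rhoOf_eq_rhoB, update_eq_shift, update_eq_shift, hb, rhoB_eq_core, rhoB_eq_core,
      rhoCore_permLower, shift_permLower]
    simp only [coeffU_permLower, coeffW_permLower]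
    rw [← hj]
    ring
  have hPh : dictPhat (g a) (i.val + 1) * (prodFNat (bOfA a) : ℚ) = dictPhat a j * (prodFNat (bOfA (g a)) : ℚ) := by
    unfold dictPhat
    rw [rhoOf_eq_rhoB, rhoOf_eq_rhoB, update_eq_shift, update_eq_shift, hb, rhoB_eq_core, rhoB_eq_core,
      rhoCore_permLower, shift_permLower]
    simp only [coeffU_permLower, coeffV_permLower]
    rw [← hj]
    ring
  have hP : dictP (g a) (i.val + 1) * (prodFNat (bOfA a) : ℚ) = dictP a j * (prodFNat (bOfA (g a)) : ℚ) := by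
    unfold dictP
    rw [rhoOf_eq_rhoB, rhoOf_eq_rhoB, update_eq_shift, update_eq_shift, hb, rhoB_eq_core, rhoB_eq_core,
      rhoCore_permLower, shift_permLower]
    simp only [coeffW_permLower, coeffV_permLower]
    rw [← hj]
    ring
  -- cast to `ℝ`
  have hQr : (QOf (g a) : ℝ) * ((prodFNat (bOfA a) : ℕ) : ℝ) = (QOf a : ℝ) * ((prodFNat (bOfA (g a)) : ℕ) : ℝ) := by
    exact_mod_cast hQ
  have hPhr : (dictPhat (g a) (i.val + 1) : ℝ) * ((prodFNat (bOfA a) : ℕ) : ℝ) =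
      (dictPhat a j : ℝ) * ((prodFNat (bOfA (g a)) : ℕ) : ℝ) := by
    exact_mod_cast hPh
  have hPr : (dictP (g a) (i.val + 1) : ℝ) * ((prodFNat (bOfA a) : ℕ) : ℝ) =
      (dictP a j : ℝ) * ((prodFNat (bOfA (g a)) : ℕ) : ℝ) := by
    exact_mod_cast hP
  unfold ExplicitPQAt at h ⊢
  refine mul_right_cancel₀ hF1.ne' ?_
  linear_combination hIa + ((prodFNat (bOfA (g a)) : ℕ) : ℝ) * h -
    (2 * zetaValue 5 + 4 * zetaValue 3 * zetaValue 2) * hQr + 4 * zetaValue 2 * hPhr + 2 * hPr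

/-! ## 3. The generators `p₀₁, p₁₂, h, h'` as slot transpositions -/

/-! ## 4. Transport along the four generators (modulo the cited invariance (27) only) -/

/-- **`explicitPQ` transports along `p₀₁`** (slots `3 ↔ 4`): from partner `j = (34)(i)+1` at `a` to partner `i+1` at `p₀₁ a`,
given the hypotheses of `explicitPQ` at `a`, convergence at `p₀₁ a`, and (27). -/
theorem explicitPQAt_genP01 (hInv : invariance_of_converges') {a : Fin 8 → ℤ} (i : Fin 7) {j : ℕ}
    (hj : j = ((Equiv.swap (2 : Fin 7) 3) i).val + 1) (hr : RegionHyp a j) (hc : Converges (genP01 a))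
    (h : ExplicitPQAt a j) : ExplicitPQAt (genP01 a) (i.val + 1) := by
  exact explicitPQAt_transport (bOfA_genP01 a) ((hInv a hr.2.1).2.1 hc) i hj hr
    (regionHyp_transport (bOfA_genP01 a) hc i hj hr) h

/-- **`explicitPQ` transports along `p₁₂`** (slots `3 ↔ 5`). -/
theorem explicitPQAt_genP12 (hInv : invariance_of_converges') {a : Fin 8 → ℤ} (i : Fin 7) {j : ℕ}
    (hj : j = ((Equiv.swap (2 : Fin 7) 4) i).val + 1) (hr : RegionHyp a j) (hc : Converges (genP12 a))
    (h : ExplicitPQAt a j) : ExplicitPQAt (genP12 a) (i.val + 1) := by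
  exact explicitPQAt_transport (bOfA_genP12 a) ((hInv a hr.2.1).2.2.1 hc) i hj hr
    (regionHyp_transport (bOfA_genP12 a) hc i hj hr) h

/-- **`explicitPQ` transports along `h`** (slots `3 ↔ 6`). -/
theorem explicitPQAt_genH (hInv : invariance_of_converges') {a : Fin 8 → ℤ} (i : Fin 7) {j : ℕ}
    (hj : j = ((Equiv.swap (2 : Fin 7) 5) i).val + 1) (hr : RegionHyp a j) (hc : Converges (genH a))
    (h : ExplicitPQAt a j) : ExplicitPQAt (genH a) (i.val + 1) := by
  exact explicitPQAt_transport (bOfA_genH a) ((hInv a hr.2.1).2.2.2.1 hc) i hj hr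
    (regionHyp_transport (bOfA_genH a) hc i hj hr) h

/-- **`explicitPQ` transports along `h'`** (slots `4 ↔ 6`). -/
theorem explicitPQAt_genHp (hInv : invariance_of_converges') {a : Fin 8 → ℤ} (i : Fin 7) {j : ℕ}
    (hj : j = ((Equiv.swap (3 : Fin 7) 5) i).val + 1) (hr : RegionHyp a j) (hc : Converges (genH' a))
    (h : ExplicitPQAt a j) : ExplicitPQAt (genH' a) (i.val + 1) := by
  exact explicitPQAt_transport (bOfA_genHp a) ((hInv a hr.2.1).2.2.2.2 hc) i hj hr
    (regionHyp_transport (bOfA_genHp a) hc i hj hr) h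

/-! ## 5. Sanity check (values from the memo) -/

/-- At `a = (1,3,2,1,2,1,2,2)` (the tree's `normalisation_witness`): `prodFNat (b(a)) = 10368 = ∏_{i∈F} h_i(a)!` and
`prodFNat (b(p₁₂ a)) = 31104`. -/
example : prodFNat (bOfA ![1, 3, 2, 1, 2, 1, 2, 2]) = 10368 ∧ prodFNat (bOfA ![1, 3, 0, 3, 0, 3, 2, 2]) = 31104 := by
  decide

end Summit.KontsevichZagierPeriods.Zeta5Search.WedgeDictionary
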